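import Summits.Ventures.CertifiedManyBodySolver.Downfold.EmeryOrbitalWeightFaceDirBox
import Summits.Ventures.CertifiedManyBodySolver.Downfold.EmeryVanHoveSubBox
import Summits.Ventures.CertifiedManyBodySolver.Downfold.EmeryVanHoveTableB
import Summits.Ventures.CertifiedManyBodySolver.Downfold.EmeryFermiFaceDirPointsYBCO7planeK26NH116S1
import Summits.Ventures.CertifiedManyBodySolver.Downfold.EmeryFermiFaceDirPointsYBCO7planeK26NH116S2
import Summits.Ventures.CertifiedManyBodySolver.Downfold.EmeryFermiFaceDirPointsYBCO7planeK26NH116S3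
import HarnessLib

/-!
# THE ANTINODAL FERMI-SURFACE Cu-d WEIGHT OVER THE TYPED 3BE BOX `emeryBoxYBCO7planeY6K26Src (EmeryBoxesKSlicesE)` AT FILLING n_H = 1.16 (ν = 21/50), regime-free rule v2 — the kinematic leg of the UPPER member
# `U_B∣full(w_antinode)` of the weak band-level `U` bracket read over a box where the v1 rule's antinodal charge-transfer regime FAILS at the low-Δ corners
# (INFL-3to1-B §B.90 (j); kernel `EmeryOrbitalWeightFaceDirBox`; router/EMERY-FS-WEIGHT-BRACKETS.tsv / OBJECT-E-BUDGET.tsv §C)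

Venture CertifiedManyBodySolver, cell `pub/hubbard-downfold` (stage S1), seat hubbard-downfold-mod-4 (technique B, g39); namespace
`Summit.Ventures.CertifiedManyBodySolver.Downfold.Emery`. Everything PROVED (0 sorry). WHAT THIS IS NOT: a statement about the material — the typed box (YBa₂Cu₃O₇ plane Cu(2) ((K) #66-type source box))
is SCREENING-GRADE; `U = 0` one-body kinematics of the σ model; the `U_B` arithmetic that consumes the window is DERIVED context on the MEAN-FIELD annex (R-B17).

For every member θ = (Δ, t_pd, t_pp, t_pp′) ∈ [1.75, 2.35] × [1.17, 1.39] × [0.61, 0.73] × [0.15, 0.15] eV at filling ν = 21/50, the Cu-d weight of the ANTINODAL Bloch state,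
`dWeightFace θ (fermiEnergyOf θ ν)`, lies in the window below. DEVICE (v2): `W(θ) = W(Δ/t_pd, 1, t_pp/t_pd, t_pp′/t_pd)` (scaling law); the t_pd range is cut into 3 slabs; on each
normalised slab the v2 CORNER RULE `dWeightFace_fermiEnergyOf_mem_Icc_of_mem_box3_dir_num`: Δ ↑ at fixed filling WITHOUT the regime (region-wide directional certificate
`faceDir_nonneg_of_mem_region`, κ₀ = 1/10, + the Fermi-energy slope law κ = 1/10 + mean value theorem), t_pp ↓, t_pp′ ↑ only at the upper corner (regime margin R2 there),
lower end `t_pp′`-decoupled (`dWeightFaceLoDec` at `E_h`); hole-likeness from the slab's `vhBoxCheck` + the Ψ table; two K = 384 Fermi-energy brackets per slab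
(`EmeryFermiFaceDirPointsYBCO7planeK26NH116S<k>`). The slab corners are VIRTUAL (not members): the window is a sound ENCLOSURE (lower end ≈ 0.02 below the v1 virtual-corner value).

| t_pd slab (eV) | normalised slab Δ/t_pd × t_pp/t_pd × t_pp′/t_pd | q₁ (vhBoxCheck) ≥ table point | E_h | E_v | margins (R2, 1 − κ − w̄_axis) | **w_face window** |
|---|---|---|---|---|---|---|
| [1.17, 1.243] | [1.408, 2.009] × [0.4906, 0.6239] × [0.1206, 0.1282] | 0.5455 ≥ 27/50 (Ψ ≤ 0.3881) | 1.3738 | 1.1391 | +0.672, +0.135 | **[0.6772, 0.7564]** |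
| [1.243, 1.317] | [1.329, 1.89] × [0.4633, 0.5871] × [0.1139, 0.1206] | 0.5248 ≥ 13/25 (Ψ ≤ 0.3906) | 1.3966 | 1.1718 | +0.726, +0.147 | **[0.6705, 0.7458]** |
| [1.317, 1.39] | [1.259, 1.785] × [0.4388, 0.5544] × [0.1079, 0.1139] | 0.5052 ≥ 101/200 (Ψ ≤ 0.3925) | 1.4167 | 1.2013 | +0.775, +0.157 | **[0.6646, 0.7361]** |
| **whole box** | (hull of the slabs) | | | | | **[0.6646, 0.7564]** |

Sources: three-band model [HybertsenSchluterChristensen1989, Eq. (1)]; face point of the bilinear contour [AndersenEtAl1995, §6]; [folklore] algebra.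
-/

noncomputable section

namespace Summit.Ventures.CertifiedManyBodySolver.Downfold.Emery

open Real Set

/-- **Slab 1 (t_pd ∈ [1.17, 1.243] eV) of `emeryBoxYBCO7planeY6K26Src (EmeryBoxesKSlicesE)`, ν = 21/50: the antinodal Fermi-surface Cu-d weight of every member lies in `[0.6772, 0.7564]`**
(normalised-slab v2 corner rule; brackets `faceDirPt_YBCO7planeK26_nH116_s1_lo_br` / `_hi_br`). [folklore] -/
theorem yBCO7planeK26Box_dWeightFaceDir_nH116_s1 {Δ a b c : ℝ} (hΔ : Δ ∈ Icc ((7 : ℝ) / 4) ((47 : ℝ) / 20)) (ha : a ∈ Icc ((117 : ℝ) / 100) ((373 : ℝ) / 300)) (hb : b ∈ Icc ((61 : ℝ) / 100) ((73 : ℝ) / 100)) (hc : c ∈ Icc ((3 : ℝ) / 20) ((3 : ℝ) / 20)) :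
    dWeightFace Δ a b c (fermiEnergyOf Δ a b c ((21 : ℝ) / 50)) ∈ Icc ((1693 : ℝ) / 2500) ((1891 : ℝ) / 2500) := by
  have ha0 : 0 < a := lt_of_lt_of_le (by norm_num) ha.1
  rw [dWeightFace_fermiEnergyOf_eq_ratios ha0]
  have hΔn : Δ / a ∈ Icc ((525 : ℝ) / 373) ((235 : ℝ) / 117) := by
    constructor
    · rw [le_div_iff₀ ha0]; linarith [hΔ.1, ha.2]
    · rw [div_le_iff₀ ha0]; linarith [hΔ.2, ha.1]
  have hbn : b / a ∈ Icc ((183 : ℝ) / 373) ((73 : ℝ) / 117) := by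
    constructor
    · rw [le_div_iff₀ ha0]; linarith [hb.1, ha.2]
    · rw [div_le_iff₀ ha0]; linarith [hb.2, ha.1]
  have hcn : c / a ∈ Icc ((45 : ℝ) / 373) ((5 : ℝ) / 39) := by
    constructor
    · rw [le_div_iff₀ ha0]; linarith [hc.1, ha.2]
    · rw [div_le_iff₀ ha0]; linarith [hc.2, ha.1]
  have hVH : ∀ Δ' b' c' : ℝ, Δ' ∈ Icc ((525 : ℝ) / 373) ((235 : ℝ) / 117) → b' ∈ Icc ((183 : ℝ) / 373) ((73 : ℝ) / 117) → c' ∈ Icc ((45 : ℝ) / 373) ((5 : ℝ) / 39) →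
      1 - 2 * ((21 : ℝ) / 50) ≤ xVH Δ' 1 b' c' := by
    intro Δ' b' c' hΔ' hb' hc'
    have h := xVH_window_of_vhBoxCheck (Δ₁ := ((525 : ℚ) / 373)) (Δ₂ := ((235 : ℚ) / 117)) (a₁ := (1 : ℚ)) (a₂ := (1 : ℚ)) (b₁ := ((183 : ℚ) / 373)) (b₂ := ((73 : ℚ) / 117))
      (c₁ := ((45 : ℚ) / 373)) (c₂ := ((5 : ℚ) / 39)) (v₁ := ((5517 : ℚ) / 5000)) (v₂ := ((1267 : ℚ) / 1000)) (e := ((12583 : ℚ) / 10000)) (E := ((5553 : ℚ) / 5000))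
      (q₁ := ((1091 : ℚ) / 2000)) (q₂ := ((2207 : ℚ) / 2500)) (by decide +kernel)
      (Δ := Δ') (tpd := 1) (tpp := b') (c := c') (by simpa using hΔ') (by simp) (by simpa using hb') (by simpa using hc')
    obtain ⟨-, -, -, -, -, hwin⟩ := h
    push_cast at hwin
    have ht := vhFrac_27_50
    have hmono := vhFrac_anti (show (27 / 50 : ℝ) ≤ ((1091 : ℝ) / 2000) by norm_num)
    have hnu : ((57230 : ℝ) / 147456) ≤ ((21 : ℝ) / 50) := by norm_num
    linarith [hwin.1, ht.2]
  have hEh := (fermiEnergyOf_of_pointBracketCheck faceDirPt_YBCO7planeK26_nH116_s1_lo_br (by norm_num) (by norm_num) (by norm_num) (ν := (21/50 : ℝ))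
    (by push_cast; exact ⟨le_rfl, le_rfl⟩)).2
  have hEv := (fermiEnergyOf_of_pointBracketCheck faceDirPt_YBCO7planeK26_nH116_s1_hi_br (by norm_num) (by norm_num) (by norm_num) (ν := (21/50 : ℝ))
    (by push_cast; exact ⟨le_rfl, le_rfl⟩)).2
  push_cast at hEh hEv
  refine dWeightFace_fermiEnergyOf_mem_Icc_of_mem_box3_dir_num (Eh := ((6869 : ℝ) / 5000)) (Ev := ((11391 : ℝ) / 10000)) (Elow := ((11291 : ℝ) / 10000)) (κ₀ := 1 / 10) (κ := 1 / 10)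
    (by norm_num) one_pos (by norm_num) (by norm_num) (by norm_num) hΔn hbn hcn (by norm_num) (by norm_num) hVH hEh.2 (by norm_num)
    (by norm_num [faceU, fsD, fsN, cA]) (by norm_num [faceU, fsD, fsN, cA]) (by norm_num [faceU, fsD, fsN, cA]) (by norm_num [faceU, fsD, fsN, cA])
    hEv.1 (by norm_num) (by norm_num) (by norm_num [faceG]) (by norm_num) (by norm_num) (by norm_num) le_rfl (by norm_num [dWeightAxisCF])
    (by norm_num) (by norm_num) ?_ (by norm_num [dWeightFaceLoDec, faceRUp, faceN]) (by norm_num [dWeightFaceCF, faceN, faceR, fsN])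
  intro D B C e hD hB hC he hG
  exact faceDir_nonneg_of_mem_region ⟨le_trans (by norm_num) hD.1, le_trans hD.2 (by norm_num)⟩ ⟨le_trans (by norm_num) he.1, le_trans he.2 (by norm_num)⟩
    ⟨le_trans (by norm_num) hB.1, le_trans hB.2 (by norm_num)⟩ ⟨le_trans (by norm_num) hC.1, le_trans hC.2 (by norm_num)⟩ hG

/-- **Slab 2 (t_pd ∈ [1.243, 1.317] eV) of `emeryBoxYBCO7planeY6K26Src (EmeryBoxesKSlicesE)`, ν = 21/50: the antinodal Fermi-surface Cu-d weight of every member lies in `[0.6705, 0.7458]`**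
(normalised-slab v2 corner rule; brackets `faceDirPt_YBCO7planeK26_nH116_s2_lo_br` / `_hi_br`). [folklore] -/
theorem yBCO7planeK26Box_dWeightFaceDir_nH116_s2 {Δ a b c : ℝ} (hΔ : Δ ∈ Icc ((7 : ℝ) / 4) ((47 : ℝ) / 20)) (ha : a ∈ Icc ((373 : ℝ) / 300) ((79 : ℝ) / 60)) (hb : b ∈ Icc ((61 : ℝ) / 100) ((73 : ℝ) / 100)) (hc : c ∈ Icc ((3 : ℝ) / 20) ((3 : ℝ) / 20)) :
    dWeightFace Δ a b c (fermiEnergyOf Δ a b c ((21 : ℝ) / 50)) ∈ Icc ((1341 : ℝ) / 2000) ((3729 : ℝ) / 5000) := by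
  have ha0 : 0 < a := lt_of_lt_of_le (by norm_num) ha.1
  rw [dWeightFace_fermiEnergyOf_eq_ratios ha0]
  have hΔn : Δ / a ∈ Icc ((105 : ℝ) / 79) ((705 : ℝ) / 373) := by
    constructor
    · rw [le_div_iff₀ ha0]; linarith [hΔ.1, ha.2]
    · rw [div_le_iff₀ ha0]; linarith [hΔ.2, ha.1]
  have hbn : b / a ∈ Icc ((183 : ℝ) / 395) ((219 : ℝ) / 373) := by
    constructor
    · rw [le_div_iff₀ ha0]; linarith [hb.1, ha.2]
    · rw [div_le_iff₀ ha0]; linarith [hb.2, ha.1]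
  have hcn : c / a ∈ Icc ((9 : ℝ) / 79) ((45 : ℝ) / 373) := by
    constructor
    · rw [le_div_iff₀ ha0]; linarith [hc.1, ha.2]
    · rw [div_le_iff₀ ha0]; linarith [hc.2, ha.1]
  have hVH : ∀ Δ' b' c' : ℝ, Δ' ∈ Icc ((105 : ℝ) / 79) ((705 : ℝ) / 373) → b' ∈ Icc ((183 : ℝ) / 395) ((219 : ℝ) / 373) → c' ∈ Icc ((9 : ℝ) / 79) ((45 : ℝ) / 373) →
      1 - 2 * ((21 : ℝ) / 50) ≤ xVH Δ' 1 b' c' := by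
    intro Δ' b' c' hΔ' hb' hc'
    have h := xVH_window_of_vhBoxCheck (Δ₁ := ((105 : ℚ) / 79)) (Δ₂ := ((705 : ℚ) / 373)) (a₁ := (1 : ℚ)) (a₂ := (1 : ℚ)) (b₁ := ((183 : ℚ) / 395)) (b₂ := ((219 : ℚ) / 373))
      (c₁ := ((9 : ℚ) / 79)) (c₂ := ((45 : ℚ) / 373)) (v₁ := ((1139 : ℚ) / 1000)) (v₂ := ((12977 : ℚ) / 10000)) (e := ((12897 : ℚ) / 10000)) (E := ((11457 : ℚ) / 10000))
      (q₁ := ((328 : ℚ) / 625)) (q₂ := ((1041 : ℚ) / 1250)) (by decide +kernel)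
      (Δ := Δ') (tpd := 1) (tpp := b') (c := c') (by simpa using hΔ') (by simp) (by simpa using hb') (by simpa using hc')
    obtain ⟨-, -, -, -, -, hwin⟩ := h
    push_cast at hwin
    have ht := vhFrac_13_25
    have hmono := vhFrac_anti (show (13 / 25 : ℝ) ≤ ((328 : ℝ) / 625) by norm_num)
    have hnu : ((57603 : ℝ) / 147456) ≤ ((21 : ℝ) / 50) := by norm_num
    linarith [hwin.1, ht.2]
  have hEh := (fermiEnergyOf_of_pointBracketCheck faceDirPt_YBCO7planeK26_nH116_s2_lo_br (by norm_num) (by norm_num) (by norm_num) (ν := (21/50 : ℝ))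
    (by push_cast; exact ⟨le_rfl, le_rfl⟩)).2
  have hEv := (fermiEnergyOf_of_pointBracketCheck faceDirPt_YBCO7planeK26_nH116_s2_hi_br (by norm_num) (by norm_num) (by norm_num) (ν := (21/50 : ℝ))
    (by push_cast; exact ⟨le_rfl, le_rfl⟩)).2
  push_cast at hEh hEv
  refine dWeightFace_fermiEnergyOf_mem_Icc_of_mem_box3_dir_num (Eh := ((6983 : ℝ) / 5000)) (Ev := ((5859 : ℝ) / 5000)) (Elow := ((5809 : ℝ) / 5000)) (κ₀ := 1 / 10) (κ := 1 / 10)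
    (by norm_num) one_pos (by norm_num) (by norm_num) (by norm_num) hΔn hbn hcn (by norm_num) (by norm_num) hVH hEh.2 (by norm_num)
    (by norm_num [faceU, fsD, fsN, cA]) (by norm_num [faceU, fsD, fsN, cA]) (by norm_num [faceU, fsD, fsN, cA]) (by norm_num [faceU, fsD, fsN, cA])
    hEv.1 (by norm_num) (by norm_num) (by norm_num [faceG]) (by norm_num) (by norm_num) (by norm_num) le_rfl (by norm_num [dWeightAxisCF])
    (by norm_num) (by norm_num) ?_ (by norm_num [dWeightFaceLoDec, faceRUp, faceN]) (by norm_num [dWeightFaceCF, faceN, faceR, fsN])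
  intro D B C e hD hB hC he hG
  exact faceDir_nonneg_of_mem_region ⟨le_trans (by norm_num) hD.1, le_trans hD.2 (by norm_num)⟩ ⟨le_trans (by norm_num) he.1, le_trans he.2 (by norm_num)⟩
    ⟨le_trans (by norm_num) hB.1, le_trans hB.2 (by norm_num)⟩ ⟨le_trans (by norm_num) hC.1, le_trans hC.2 (by norm_num)⟩ hG

/-- **Slab 3 (t_pd ∈ [1.317, 1.39] eV) of `emeryBoxYBCO7planeY6K26Src (EmeryBoxesKSlicesE)`, ν = 21/50: the antinodal Fermi-surface Cu-d weight of every member lies in `[0.6646, 0.7361]`**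
(normalised-slab v2 corner rule; brackets `faceDirPt_YBCO7planeK26_nH116_s3_lo_br` / `_hi_br`). [folklore] -/
theorem yBCO7planeK26Box_dWeightFaceDir_nH116_s3 {Δ a b c : ℝ} (hΔ : Δ ∈ Icc ((7 : ℝ) / 4) ((47 : ℝ) / 20)) (ha : a ∈ Icc ((79 : ℝ) / 60) ((139 : ℝ) / 100)) (hb : b ∈ Icc ((61 : ℝ) / 100) ((73 : ℝ) / 100)) (hc : c ∈ Icc ((3 : ℝ) / 20) ((3 : ℝ) / 20)) :
    dWeightFace Δ a b c (fermiEnergyOf Δ a b c ((21 : ℝ) / 50)) ∈ Icc ((3323 : ℝ) / 5000) ((7361 : ℝ) / 10000) := by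
  have ha0 : 0 < a := lt_of_lt_of_le (by norm_num) ha.1
  rw [dWeightFace_fermiEnergyOf_eq_ratios ha0]
  have hΔn : Δ / a ∈ Icc ((175 : ℝ) / 139) ((141 : ℝ) / 79) := by
    constructor
    · rw [le_div_iff₀ ha0]; linarith [hΔ.1, ha.2]
    · rw [div_le_iff₀ ha0]; linarith [hΔ.2, ha.1]
  have hbn : b / a ∈ Icc ((61 : ℝ) / 139) ((219 : ℝ) / 395) := by
    constructor
    · rw [le_div_iff₀ ha0]; linarith [hb.1, ha.2]
    · rw [div_le_iff₀ ha0]; linarith [hb.2, ha.1]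
  have hcn : c / a ∈ Icc ((15 : ℝ) / 139) ((9 : ℝ) / 79) := by
    constructor
    · rw [le_div_iff₀ ha0]; linarith [hc.1, ha.2]
    · rw [div_le_iff₀ ha0]; linarith [hc.2, ha.1]
  have hVH : ∀ Δ' b' c' : ℝ, Δ' ∈ Icc ((175 : ℝ) / 139) ((141 : ℝ) / 79) → b' ∈ Icc ((61 : ℝ) / 139) ((219 : ℝ) / 395) → c' ∈ Icc ((15 : ℝ) / 139) ((9 : ℝ) / 79) →
      1 - 2 * ((21 : ℝ) / 50) ≤ xVH Δ' 1 b' c' := by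
    intro Δ' b' c' hΔ' hb' hc'
    have h := xVH_window_of_vhBoxCheck (Δ₁ := ((175 : ℚ) / 139)) (Δ₂ := ((141 : ℚ) / 79)) (a₁ := (1 : ℚ)) (a₂ := (1 : ℚ)) (b₁ := ((61 : ℚ) / 139)) (b₂ := ((219 : ℚ) / 395))
      (c₁ := ((15 : ℚ) / 139)) (c₂ := ((9 : ℚ) / 79)) (v₁ := ((11721 : ℚ) / 10000)) (v₂ := ((663 : ℚ) / 500)) (e := ((6593 : ℚ) / 5000)) (E := ((11783 : ℚ) / 10000))
      (q₁ := ((1263 : ℚ) / 2500)) (q₂ := ((1969 : ℚ) / 2500)) (by decide +kernel)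
      (Δ := Δ') (tpd := 1) (tpp := b') (c := c') (by simpa using hΔ') (by simp) (by simpa using hb') (by simpa using hc')
    obtain ⟨-, -, -, -, -, hwin⟩ := h
    push_cast at hwin
    have ht := vhFrac_101_200
    have hmono := vhFrac_anti (show (101 / 200 : ℝ) ≤ ((1263 : ℝ) / 2500) by norm_num)
    have hnu : ((57877 : ℝ) / 147456) ≤ ((21 : ℝ) / 50) := by norm_num
    linarith [hwin.1, ht.2]
  have hEh := (fermiEnergyOf_of_pointBracketCheck faceDirPt_YBCO7planeK26_nH116_s3_lo_br (by norm_num) (by norm_num) (by norm_num) (ν := (21/50 : ℝ))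
    (by push_cast; exact ⟨le_rfl, le_rfl⟩)).2
  have hEv := (fermiEnergyOf_of_pointBracketCheck faceDirPt_YBCO7planeK26_nH116_s3_hi_br (by norm_num) (by norm_num) (by norm_num) (ν := (21/50 : ℝ))
    (by push_cast; exact ⟨le_rfl, le_rfl⟩)).2
  push_cast at hEh hEv
  refine dWeightFace_fermiEnergyOf_mem_Icc_of_mem_box3_dir_num (Eh := ((14167 : ℝ) / 10000)) (Ev := ((12013 : ℝ) / 10000)) (Elow := ((11913 : ℝ) / 10000)) (κ₀ := 1 / 10) (κ := 1 / 10)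
    (by norm_num) one_pos (by norm_num) (by norm_num) (by norm_num) hΔn hbn hcn (by norm_num) (by norm_num) hVH hEh.2 (by norm_num)
    (by norm_num [faceU, fsD, fsN, cA]) (by norm_num [faceU, fsD, fsN, cA]) (by norm_num [faceU, fsD, fsN, cA]) (by norm_num [faceU, fsD, fsN, cA])
    hEv.1 (by norm_num) (by norm_num) (by norm_num [faceG]) (by norm_num) (by norm_num) (by norm_num) le_rfl (by norm_num [dWeightAxisCF])
    (by norm_num) (by norm_num) ?_ (by norm_num [dWeightFaceLoDec, faceRUp, faceN]) (by norm_num [dWeightFaceCF, faceN, faceR, fsN])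
  intro D B C e hD hB hC he hG
  exact faceDir_nonneg_of_mem_region ⟨le_trans (by norm_num) hD.1, le_trans hD.2 (by norm_num)⟩ ⟨le_trans (by norm_num) he.1, le_trans he.2 (by norm_num)⟩
    ⟨le_trans (by norm_num) hB.1, le_trans hB.2 (by norm_num)⟩ ⟨le_trans (by norm_num) hC.1, le_trans hC.2 (by norm_num)⟩ hG

/-- **`emeryBoxYBCO7planeY6K26Src (EmeryBoxesKSlicesE)`, ν = 21/50: for EVERY member θ the Cu-d weight of the antinodal Fermi-surface state lies in `[0.6646, 0.7564]`** (hull of the 3 t_pd slab windows; regime-free rule v2). [folklore] -/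
theorem yBCO7planeK26Box_dWeightFaceDir_nH116 {Δ a b c : ℝ} (hΔ : Δ ∈ Icc ((7 : ℝ) / 4) ((47 : ℝ) / 20)) (ha : a ∈ Icc ((117 : ℝ) / 100) ((139 : ℝ) / 100)) (hb : b ∈ Icc ((61 : ℝ) / 100) ((73 : ℝ) / 100)) (hc : c ∈ Icc ((3 : ℝ) / 20) ((3 : ℝ) / 20)) :
    dWeightFace Δ a b c (fermiEnergyOf Δ a b c ((21 : ℝ) / 50)) ∈ Icc ((3323 : ℝ) / 5000) ((1891 : ℝ) / 2500) := by
  rcases le_or_gt a ((373 : ℝ) / 300) with h1 | h1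
  · have h := yBCO7planeK26Box_dWeightFaceDir_nH116_s1 hΔ ⟨ha.1, h1⟩ hb hc
    exact ⟨le_trans (by norm_num) h.1, le_trans h.2 (by norm_num)⟩
  · rcases le_or_gt a ((79 : ℝ) / 60) with h2 | h2
    · have h := yBCO7planeK26Box_dWeightFaceDir_nH116_s2 hΔ ⟨h1.le, h2⟩ hb hc
      exact ⟨le_trans (by norm_num) h.1, le_trans h.2 (by norm_num)⟩
    · have h := yBCO7planeK26Box_dWeightFaceDir_nH116_s3 hΔ ⟨h2.le, ha.2⟩ hb hc
      exact ⟨le_trans (by norm_num) h.1, le_trans h.2 (by norm_num)⟩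

end Summit.Ventures.CertifiedManyBodySolver.Downfold.Emery
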